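import Summits.CriticalPhenomena.PercolationContinuityZ3.Theorems.PercNearOneGluingNoHeavyConstsLinearLowerTailGluedGroups
import HarnessLib

/-!
# The reach-free linear lower tail is at most HALF THE TOUR: `P(1 ≤ N < κ·EN) ≤ ½·Σ_k P(u_k ↮ u_{k+1})` for any closed tour of `A`

builds on p205010 (kernel theorem, internal audit signed; external expert review pending)

PAPER-2 track "percolation constants", part (ii), seat `prim-consts-1` (lane index `run/shared/lean/prim/consts/CONSTANTS.md`,
row A19).  Support file for the crux `NoHeavyLowerTail` (stmt-CriticalPhenomena-4575; `--supports … --as helper`): theorems only,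
no definitions, no sorries, standard axioms.  Companion of `…ConstsLinearLowerTailGluedGroups` (terminal-cycle bound).

* `Consts.real_lowerTail_le_half_tour_add` — for ANY observer `o`, any closed sequence `u_0, …, u_{L−1}` (`u_L = u_0`) and any attachment
  `a ↦ u_{g a}` of the relay points: `P(1 ≤ N < κ·EN) ≤ ½ Σ_{k<L} P(u_k ↮ u_{k+1}) + Σ_a P(u_{g a} ↮ a)` (every `κ < 1`); the sharper
  form of `real_lowerTail_le_half_cycle_add` keeping the actual consecutive unreliabilities.
* `Consts.real_lowerTail_le_half_tour` — with `u` a tour visiting all of `A`: `P(1 ≤ N < κ·EN) ≤ ½·(length of the tour in the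
  pseudometric d(a,a′) = P(a ↮ a′))`, in particular `≤ ½·TSP_d(A)`.  For CLUSTERED relay sets the shortest tour is `(number of
  clusters)·s` up to the in-cluster defects, recovering the glued-groups theorems; for DIFFUSE relay sets (all distances `≈ s`) the tour
  has length `≈ |A|·s` and the bound is void — that regime is what remains open of `Consts.LinearLowerTailThreeHalves`, which asserts
  `(3/2)·(diameter)` instead of `½·(tour length)`.
* `Consts.real_lowerTail_le_half_add_half_of_glued'` — `b` internally reliable groups covering `A ∖ {o}`, ANY observer (in `A` or
  not): `P(1 ≤ N < κ·EN) ≤ ((1+b)/2)·s` (for `o ∉ A` even `(b/2)·s`).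
References: G. Kozma, N. Nitzan, arXiv:2401.12397 (2024), Conjecture 1 (p. 3); G. Grimmett, *Percolation* (1999), §1.3.
-/

noncomputable section

namespace Summit.CriticalPhenomena.PercolationContinuityZ3.Theorems

open MeasureTheory Set Literature.Probability.LatticeModels Literature.Probability.Percolation
open scoped Classical

namespace Consts

/-- **Half the tour.**  For ANY observer `o`, any closed sequence of relay points `u_0, …, u_{L−1} ∈ A` (`u_L = u_0`) and any attachment
`a ↦ u_{g a}` of the relay points to the sequence (`η := Σ_{a∈A} P(u_{g a} ↮ a)`), for every `κ < 1`:
`P(1 ≤ N < κ·EN) ≤ ½ Σ_{k<L} P(u_k ↮ u_{k+1}) + η`.  With `u` a tour through all of `A` and `g` the position map (`η = 0`) this reads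
`P(1 ≤ N < κ·EN) ≤ ½ · (length of the tour in the pseudometric d(a,a′) = P(a ↮ a′))`, so `≤ ½·TSP_d(A)`; the companion bound
`real_lowerTail_le_half_cycle_add` is the case "every step ≤ s". [cite: KozmaNitzan2024, Conj. 1 (p. 3)] -/
theorem real_lowerTail_le_half_tour_add (n : ℕ) (w : Sym2 (Fin n) → unitInterval) (A : Finset (Fin n)) (o : Fin n)
    (L : ℕ) (u : ℕ → Fin n) (huL : u L = u 0) (g : Fin n → ℕ) (hg : ∀ a ∈ A, g a < L) {κ : ℝ} (hκ : κ < 1) :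
    (prodBernoulli w).real {ω : BondConfig (Fin n) | 1 ≤ (A.filter fun a => ω ∈ openConn o a).card ∧
        ((A.filter fun a => ω ∈ openConn o a).card : ℝ) < κ * (∑ a ∈ A, (prodBernoulli w).real (openConn o a))} ≤
      (1 / 2) * (∑ k ∈ Finset.range L, (prodBernoulli w).real (openConn (u k) (u (k + 1)))ᶜ) +
        ∑ a ∈ A, (prodBernoulli w).real (openConn (u (g a)) a)ᶜ := by
  set μ := prodBernoulli w with hμ
  set EN : ℝ := ∑ a ∈ A, μ.real (openConn o a) with hEN
  set bad := {ω : BondConfig (Fin n) | 1 ≤ (A.filter fun a => ω ∈ openConn o a).card ∧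
        ((A.filter fun a => ω ∈ openConn o a).card : ℝ) < κ * EN} with hbad
  set Z := {ω : BondConfig (Fin n) | ∃ a ∈ A, ω ∉ openConn (u (g a)) a} with hZ
  have hZle : μ.real Z ≤ ∑ a ∈ A, μ.real (openConn (u (g a)) a)ᶜ := by
    have hU : Z = ⋃ a ∈ A, (openConn (u (g a)) a)ᶜ := by
      ext ω; simp only [hZ, mem_setOf_eq, mem_iUnion, mem_compl_iff, exists_prop]
    rw [hU]
    exact measureReal_biUnion_finset_le A _
  have hENle : EN ≤ A.card := by
    calc EN = ∑ a ∈ A, μ.real (openConn o a) := rfl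
      _ ≤ ∑ _a ∈ A, (1 : ℝ) := Finset.sum_le_sum fun a _ => measureReal_le_one
      _ = A.card := by rw [Finset.sum_const, nsmul_eq_mul, mul_one]
  set T : ℕ → Set (BondConfig (Fin n)) := fun k => (openConn (u k) (u (k + 1)))ᶜ with hT
  have hpt : ∀ ω ∈ bad \ Z, (2 : ℝ) ≤ ∑ k ∈ Finset.range L, (T k).indicator (fun _ => (1 : ℝ)) ω := by
    rintro ω ⟨⟨hN1, hNlt⟩, hωZ⟩
    simp only [hZ, mem_setOf_eq, not_exists, not_and, not_not] at hωZ
    obtain ⟨a, ha⟩ := Finset.card_pos.1 hN1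
    rw [Finset.mem_filter] at ha
    have hlt : (A.filter fun a => ω ∈ openConn o a).card < A.card := by
      have h1 : ((A.filter fun a => ω ∈ openConn o a).card : ℝ) < A.card := by
        have hENnn : 0 ≤ EN := Finset.sum_nonneg fun a _ => measureReal_nonneg
        refine hNlt.trans_le ?_
        nlinarith
      exact_mod_cast h1
    obtain ⟨a', ha'A, ha'⟩ : ∃ a' ∈ A, a' ∉ A.filter fun a => ω ∈ openConn o a := by
      by_contra hall
      push Not at hall
      exact absurd (Finset.card_le_card (fun x hx => hall x hx)) (not_le.2 hlt)
    have ha'c : ω ∉ openConn o a' := fun h => ha' (Finset.mem_filter.2 ⟨ha'A, h⟩)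
    have hta : ω ∈ openConn o (u (g a)) := ha.2.trans (SimpleGraph.Reachable.symm (hωZ a ha.1))
    have hta' : ω ∉ openConn o (u (g a')) := fun h => ha'c (h.trans (hωZ a' ha'A))
    have hsep : ω ∉ openConn (u (g a)) (u (g a')) := fun h => hta' (hta.trans h)
    have h2 := two_le_card_sep_of_cycle ω u L huL (hg a ha.1).le (hg a' ha'A).le hsep
    refine h2.trans (le_of_eq (Finset.sum_congr rfl fun k _ => ?_))
    by_cases hk : ω ∈ openConn (u k) (u (k + 1))
    · rw [if_pos hk, Set.indicator_of_notMem (show ω ∉ T k from fun h => h hk)]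
    · rw [if_neg hk, Set.indicator_of_mem (show ω ∈ T k from hk)]
  have hdc := mul_measureReal_le_sum_inter μ (bad \ Z) (Finset.range L) T 2 hpt
  have hsum : ∑ k ∈ Finset.range L, μ.real ((bad \ Z) ∩ T k) ≤ ∑ k ∈ Finset.range L, μ.real (T k) :=
    Finset.sum_le_sum fun k _ => measureReal_mono inter_subset_right (measure_ne_top _ _)
  have hsplit : μ.real bad ≤ μ.real (bad \ Z) + μ.real Z := by
    have hcov : bad ⊆ (bad \ Z) ∪ Z := fun ω hω => by
      by_cases hz : ω ∈ Z
      · exact Or.inr hz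
      · exact Or.inl ⟨hω, hz⟩
    exact (measureReal_mono hcov (measure_ne_top _ _)).trans (measureReal_union_le _ _)
  have hbz : μ.real (bad \ Z) ≤ (1 / 2) * ∑ k ∈ Finset.range L, μ.real (T k) := by linarith
  linarith

/-- **Half the tour, plain form**: with `u` a closed tour visiting every relay point (`g` = a position map, so `η = 0`), for ANY observer
and every `κ < 1`: `P(1 ≤ N < κ·EN) ≤ ½ Σ_{k<L} P(u_k ↮ u_{k+1})`. [cite: KozmaNitzan2024, Conj. 1 (p. 3)] -/
theorem real_lowerTail_le_half_tour (n : ℕ) (w : Sym2 (Fin n) → unitInterval) (A : Finset (Fin n)) (o : Fin n)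
    (L : ℕ) (u : ℕ → Fin n) (huL : u L = u 0) (hcover : ∀ a ∈ A, ∃ k, k < L ∧ u k = a) {κ : ℝ} (hκ : κ < 1) :
    (prodBernoulli w).real {ω : BondConfig (Fin n) | 1 ≤ (A.filter fun a => ω ∈ openConn o a).card ∧
        ((A.filter fun a => ω ∈ openConn o a).card : ℝ) < κ * (∑ a ∈ A, (prodBernoulli w).real (openConn o a))} ≤
      (1 / 2) * ∑ k ∈ Finset.range L, (prodBernoulli w).real (openConn (u k) (u (k + 1)))ᶜ := by
  set g : Fin n → ℕ := fun a => if h : ∃ k, k < L ∧ u k = a then Classical.choose h else 0 with hg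
  have hgL : ∀ a ∈ A, g a < L := by
    intro a ha
    simp only [hg, dif_pos (hcover a ha)]
    exact (Classical.choose_spec (hcover a ha)).1
  have hη : ∑ a ∈ A, (prodBernoulli w).real (openConn (u (g a)) a)ᶜ = 0 := by
    refine Finset.sum_eq_zero fun a ha => ?_
    have hua : u (g a) = a := by
      simp only [hg, dif_pos (hcover a ha)]
      exact (Classical.choose_spec (hcover a ha)).2
    rw [hua]
    have : (openConn a a : Set (BondConfig (Fin n))) = univ := Set.eq_univ_of_forall fun ω => SimpleGraph.Reachable.refl _
    rw [this, Set.compl_univ, measureReal_empty]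
  have h := real_lowerTail_le_half_tour_add n w A o L u huL g hgL hκ
  rw [hη, add_zero] at h
  exact h

/-- **`b` internally reliable groups, ANY observer: `P(1 ≤ N < κ·EN) ≤ ((1+b)/2)·s`.**  Terminals `x_0, …, x_{b−1} ∈ A`; every relay
point other than `o` is almost surely joined to some `x_i` (if `o ∉ A` this is every relay point, and the bound is even `(b/2)·s`).
[cite: KozmaNitzan2024, Conj. 1 (p. 3)] -/
theorem real_lowerTail_le_half_add_half_of_glued' {b : ℕ} (n : ℕ) (w : Sym2 (Fin n) → unitInterval) (A : Finset (Fin n))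
    (o : Fin n) (x : Fin b → Fin n) (hx : ∀ i, x i ∈ A)
    (hglue : ∀ a ∈ A, a = o ∨ ∃ i, (prodBernoulli w).real (openConn (x i) a) = 1)
    {κ s : ℝ} (hκ : κ < 1) (hs : 0 ≤ s)
    (hrel : ∀ a ∈ A, ∀ a' ∈ A, (prodBernoulli w).real (openConn a a')ᶜ ≤ s) :
    (prodBernoulli w).real {ω : BondConfig (Fin n) | 1 ≤ (A.filter fun a => ω ∈ openConn o a).card ∧
        ((A.filter fun a => ω ∈ openConn o a).card : ℝ) < κ * (∑ a ∈ A, (prodBernoulli w).real (openConn o a))} ≤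
      (1 + b) / 2 * s := by
  by_cases ho : o ∈ A
  · exact real_lowerTail_le_half_add_half_of_glued n w A o x ho hx hglue hκ hrel
  · -- `o ∉ A`: every relay point is attached; terminals `x_0, …, x_{b-1}` only (`L = b`)
    set μ := prodBernoulli w with hμ
    set u : ℕ → Fin n := fun k => if h : k < b then x ⟨k, h⟩ else if h0 : 0 < b then x ⟨0, h0⟩ else o with hu
    rcases Nat.eq_zero_or_pos b with hb0 | hbpos
    · -- no groups: every relay point equals `o ∉ A`, so `A = ∅` and the event is empty
      subst hb0
      have hA : A = ∅ := by
        ext a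
        simp only [Finset.notMem_empty, iff_false]
        intro ha
        rcases hglue a ha with rfl | ⟨i, -⟩
        · exact ho ha
        · exact Fin.elim0 i
      have hempty : {ω : BondConfig (Fin n) | 1 ≤ (A.filter fun a => ω ∈ openConn o a).card ∧
          ((A.filter fun a => ω ∈ openConn o a).card : ℝ) < κ * (∑ a ∈ A, μ.real (openConn o a))} = ∅ := by
        ext ω
        simp [hA]
      rw [hempty, measureReal_empty]
      positivity
    · have huA : ∀ k, k < b → u k ∈ A := by
        intro k hk; simp only [hu, hk, dif_pos]; exact hx _
      have huL : u b = u 0 := by simp [hu, hbpos]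
      set g : Fin n → ℕ := fun a => if h : ∃ i, μ.real (openConn (x i) a) = 1 then (Classical.choose h : Fin b).val else 0 with hg
      have hgL : ∀ a ∈ A, g a < b := by
        intro a _
        simp only [hg]
        split_ifs with h
        · exact (Classical.choose h).isLt
        · exact hbpos
      have hη : ∑ a ∈ A, μ.real (openConn (u (g a)) a)ᶜ = 0 := by
        refine Finset.sum_eq_zero fun a ha => ?_
        rcases hglue a ha with rfl | h
        · exact absurd ha ho
        · have hga : g a = (Classical.choose h).val := by simp [hg, h]
          have hua : u (g a) = x (Classical.choose h) := by
            rw [hga]; simp only [hu, Fin.is_lt, dif_pos, Fin.eta]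
          rw [hua, measureReal_compl MeasurableSet.of_discrete, probReal_univ, Classical.choose_spec h, sub_self]
      have h := real_lowerTail_le_half_cycle_add n w A o b u huA huL g hgL hκ hrel
      rw [hη, add_zero] at h
      refine h.trans ?_
      have : (b : ℝ) / 2 * s ≤ (1 + b) / 2 * s := by nlinarith
      exact this

/-- **Half the walk.**  For ANY observer, every `κ < 1` and every closed walk `u_0, …, u_{L−1}, u_L = u_0` in the weighted graph that
visits every relay point: `P(1 ≤ N < κ·EN) ≤ ½ Σ_{k<L} (1 − w{u_k, u_{k+1}})` — half the total failure probability of the steps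
(a step between equal vertices costs nothing useful but is allowed).  Walking a Steiner tree `T ⊇ A` there and back:
`P(1 ≤ N < κ·EN) ≤ Σ_{e∈T} (1 − w_e)`.  For the hub-leaf gadget this is `3q` against the truth `3q − 3q² + q³`. [cite: KozmaNitzan2024, Conj. 1 (p. 3)] -/
theorem real_lowerTail_le_half_walk (n : ℕ) (w : Sym2 (Fin n) → unitInterval) (A : Finset (Fin n)) (o : Fin n)
    (L : ℕ) (u : ℕ → Fin n) (huL : u L = u 0) (hcover : ∀ a ∈ A, ∃ k, k < L ∧ u k = a) {κ : ℝ} (hκ : κ < 1) :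
    (prodBernoulli w).real {ω : BondConfig (Fin n) | 1 ≤ (A.filter fun a => ω ∈ openConn o a).card ∧
        ((A.filter fun a => ω ∈ openConn o a).card : ℝ) < κ * (∑ a ∈ A, (prodBernoulli w).real (openConn o a))} ≤
      (1 / 2) * ∑ k ∈ Finset.range L, (1 - (w s(u k, u (k + 1)) : ℝ)) := by
  refine (real_lowerTail_le_half_tour n w A o L u huL hcover hκ).trans ?_
  refine mul_le_mul_of_nonneg_left (Finset.sum_le_sum fun k _ => ?_) (by norm_num)
  -- `P(u_k ↮ u_{k+1}) ≤ P(edge {u_k, u_{k+1}} closed) = 1 − w`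
  by_cases heq : u k = u (k + 1)
  · have : (openConn (u k) (u (k + 1)) : Set (BondConfig (Fin n)))ᶜ = ∅ := by
      rw [Set.compl_empty_iff, heq]
      exact Set.eq_univ_of_forall fun ω => SimpleGraph.Reachable.refl _
    rw [this, measureReal_empty]
    have h1 : ((w s(u k, u (k + 1)) : ℝ) ≤ 1) := (w s(u k, u (k + 1))).2.2
    linarith
  · have hsub : (openConn (u k) (u (k + 1)) : Set (BondConfig (Fin n)))ᶜ ⊆ {ω | s(u k, u (k + 1)) ∉ ω} :=
      fun ω hω hmem => hω (SimpleGraph.Adj.reachable ((openGraph_adj ω _ _).2 ⟨hmem, heq⟩))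
    refine (measureReal_mono hsub (measure_ne_top _ _)).trans (le_of_eq ?_)
    exact prodBernoulli_real_setOf_notMem w _

end Consts

end Summit.CriticalPhenomena.PercolationContinuityZ3.Theorems
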